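import Summits.PneNP.PneNP.Theorems.ChebyshevTracialDesignBlockDecompositionAllModes
import Summits.PneNP.PneNP.Theorems.ChebyshevTracialDesignExtendedSignMatchingSide
import HarnessLib

/-!
# Cell pnp-psdrank, route `ChebyshevTracialDesign`: the TWO-SIDED four-block price list with SIGN at all degrees on BOTH sides
# (crux `TracialDecayExp20`, stmt-PneNP-19878)

Brick 88d (prover g17; MEMO-20 §1/§2). Brick 88's `value_le_tail_of_fourBlocks` prices `X = AAᵀ + X₂`, `Y = BBᵀ + Y₂` with both Gram blocks of degree
`≤ D/2`. With the cut-side SIGN cell at all Johnson degrees `k ≤ c'/2` (brick 90 `…ExtendedSign.value_le_of_lowDegree_allModes`) and the matching-side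
SIGN cell at all matching degrees `k' ≤ c'/2` (brick 93 `…ExtendedSignMatchingSide.value_le_of_lowDegreeM_allModes`, `6k'+1 ≤ t`, `6k'+1 ≤ n−t`) the
same composition holds with no degree budget on either side: **`value_le_of_fourBlocks_allModes`** — the four cross values are SIGN∞ (cut side, twice),
SIGN∞ (matching side) and DOMINATION (87d), total `≤ r·(2·σ_X + σ_Y + B_v√P_D)` with `σ_X = B_v√P_D + 2^{2k+1}√P_{2k} + Σ_{κ∈(D/2,k]}R_κ√A_κ` and
`σ_Y` the same with `k'`. [cite: Grigoriev2001, Lemma 1.4 (PDF p. 8)] [cite: Potechin2019, Thm. 1.2 (LIPIcs 124, 61:4)] [cite: Rothvoss2017, §2 (PDF p. 6)]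
[cite: GriblingDelaatLaurent2019, §5]
Stature: support/instrument (composition; kernel lane, no defs, axioms standard). WHAT THIS IS NOT: no decomposition theorem, no proof or refutation
of the crux, nothing on psd rank of P_PM(K_n), no P-vs-NP content. Supports stmt-PneNP-19878.
-/

set_option linter.dupNamespace false -- `Summit.PneNP.PneNP.…`: summit = sub-problem (D-0017)

noncomputable section

namespace Summit.PneNP.PneNP.Theorems.ChebyshevTracialDesignFourBlocksAllModes

open Finset Matrix Literature.Barriers.PneNP Literature.Combinatorics.Optimization
open Summit.PneNP.PneNP.Theorems.ChebyshevTracialDesignBlockDecomposition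
open Summit.PneNP.PneNP.Theorems.ChebyshevTracialDesignExtendedSign (value_le_of_lowDegree_allModes)
open Summit.PneNP.PneNP.Theorems.ChebyshevTracialDesignExtendedSignMatchingSide (value_le_of_lowDegreeM_allModes)
open Summit.PneNP.PneNP.Theorems.ChebyshevTracialDesignWellConditionedDensity (value_le_tail_of_minDensity)

variable {n r : ℕ}

/-- **FOUR BLOCKS, SIGN AT ALL DEGREES ON BOTH SIDES.** For `n` even, an exact design `(n, t = 2c'+1, T, D, B_v, C, w)` with `D ≤ 2c'`,
`5D ≤ 2c'+2`, `2c'+5D ≤ n`; `X = AAᵀ + X₂` with `A` of Johnson degree `≤ k` (`D ≤ 2k ≤ c'`, `AAᵀ ⪯ I`), `Y = BBᵀ + Y₂` with `B` of matching degree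
`≤ k'` (`D ≤ 2k' ≤ c'`, `6k'+1 ≤ t`, `6k'+1 ≤ n − t`, `BBᵀ ⪯ I`), `X₂`, `Y₂` psd contractions well-conditioned against each other (`μν ≥ 64/n`):
the design value of `(X, Y)` is at most `r·(σ_k + σ_k + σ'_{k'} + B_v√P_D)` (see the file header).
[cite: Grigoriev2001, Lemma 1.4 (PDF p. 8)] [cite: Potechin2019, Thm. 1.2 (LIPIcs 124, 61:4)] [cite: Rothvoss2017, §2 (PDF p. 6)] -/
theorem value_le_of_fourBlocks_allModes {c' T D m m' k k' : ℕ} {Bv : ℝ} {C : Finset ℕ} {w : ℕ → ℝ} (hn : Even n)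
    (hdes : IsExactDesign n (2 * c' + 1) T D Bv C w) (hD : D ≤ 2 * c') (hD1 : 5 * D ≤ 2 * c' + 2) (hD2 : 2 * c' + 5 * D ≤ n)
    (hDk : D ≤ 2 * k) (hkc : 2 * k ≤ c') (hDk' : D ≤ 2 * k') (hk'c : 2 * k' ≤ c')
    (hk't : 6 * k' + 1 ≤ 2 * c' + 1) (hk'nt : 6 * k' + 1 ≤ n - (2 * c' + 1))
    (A : OddSet n → Matrix (Fin r) (Fin m) ℝ) (hA : IsLowDegreeU n k A) (hA1 : ∀ U, (1 - A U * (A U)ᵀ).PosSemidef)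
    (B : PMatch n → Matrix (Fin r) (Fin m') ℝ) (hB : IsLowDegreeM n k' B) (hB1 : ∀ M, (1 - B M * (B M)ᵀ).PosSemidef)
    (X₂ : OddSet n → Matrix (Fin r) (Fin r) ℝ) (Y₂ : PMatch n → Matrix (Fin r) (Fin r) ℝ)
    (hX₂ : ∀ U, (X₂ U).PosSemidef ∧ (1 - X₂ U).PosSemidef) (hY₂ : ∀ M, (Y₂ M).PosSemidef ∧ (1 - Y₂ M).PosSemidef)
    {μ ν : ℝ} (hμ : 0 < μ) (hν : 0 < ν) (hμν : 64 / (n : ℝ) ≤ μ * ν)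
    (hXbar : ((∑ U : OddSet n, if U.1.card = 2 * c' + 1 then X₂ U else 0) -
      (μ * (n.choose (2 * c' + 1) : ℝ)) • (1 : Matrix (Fin r) (Fin r) ℝ)).PosSemidef)
    (hYbar : ((∑ M, Y₂ M) - (ν * (Fintype.card (PMatch n) : ℝ)) • (1 : Matrix (Fin r) (Fin r) ℝ)).PosSemidef) :
    ∑ U : OddSet n, ∑ M : PMatch n,
        levelWeight n (2 * c' + 1) C w U M * ((A U * (A U)ᵀ + X₂ U) * (B M * (B M)ᵀ + Y₂ M)).trace ≤
      (r : ℝ) * (Bv * Real.sqrt (∏ i ∈ range (D / 2 + 1), ((2 * i + 1 : ℝ) / ((n : ℝ) - 2 * i))) +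
          2 ^ (2 * k + 1) * Real.sqrt (∏ i ∈ range (k + 1), ((2 * i + 1 : ℝ) / ((n : ℝ) - 2 * i))) +
          ∑ κ ∈ Ico (D / 2 + 1) (k + 1),
            (∏ i ∈ range κ, (((2 * c' + 1 : ℝ) - 2 * i) * ((n : ℝ) - 2 * c' - 1 - 2 * i) /
                (((2 * c' : ℝ) - 2 * i) * ((n : ℝ) - 2 * c' - 2 - 2 * i)))) *
              Real.sqrt (∏ i ∈ range κ, ((2 * i + 1 : ℝ) / ((n : ℝ) - 2 * i)))) * 2 +
      (r : ℝ) * (Bv * Real.sqrt (∏ i ∈ range (D / 2 + 1), ((2 * i + 1 : ℝ) / ((n : ℝ) - 2 * i))) +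
          2 ^ (2 * k' + 1) * Real.sqrt (∏ i ∈ range (k' + 1), ((2 * i + 1 : ℝ) / ((n : ℝ) - 2 * i))) +
          ∑ κ ∈ Ico (D / 2 + 1) (k' + 1),
            (∏ i ∈ range κ, (((2 * c' + 1 : ℝ) - 2 * i) * ((n : ℝ) - 2 * c' - 1 - 2 * i) /
                (((2 * c' : ℝ) - 2 * i) * ((n : ℝ) - 2 * c' - 2 - 2 * i)))) *
              Real.sqrt (∏ i ∈ range κ, ((2 * i + 1 : ℝ) / ((n : ℝ) - 2 * i)))) +
      (r : ℝ) * ((∑ c ∈ C, |w c|) * Real.sqrt (∏ i ∈ range (D / 2 + 1), ((2 * i + 1 : ℝ) / ((n : ℝ) - 2 * i)))) := by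
  have hApsd : ∀ U : OddSet n, (A U * (A U)ᵀ).PosSemidef := fun U => posSemidef_mul_transpose_self (A U)
  have hBpsd : ∀ M : PMatch n, (B M * (B M)ᵀ).PosSemidef := fun M => posSemidef_mul_transpose_self (B M)
  have hBY : ∀ M : PMatch n, (B M * (B M)ᵀ).PosSemidef ∧ (1 - B M * (B M)ᵀ).PosSemidef := fun M => ⟨hBpsd M, hB1 M⟩
  rw [value_add_left, value_add_right, value_add_right]
  have h11 := value_le_of_lowDegree_allModes hn hdes hD hDk hkc A hA hA1 (fun M => B M * (B M)ᵀ) hBY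
  have h12 := value_le_of_lowDegree_allModes hn hdes hD hDk hkc A hA hA1 Y₂ hY₂
  have h21 := value_le_of_lowDegreeM_allModes hn hdes hD hDk' hk'c hk't hk'nt X₂ hX₂ B hB hB1
  have h22 := value_le_tail_of_minDensity hn hdes hD hD1 hD2 X₂ Y₂ hX₂ hY₂ hμ hν hμν hXbar hYbar
  linarith

end Summit.PneNP.PneNP.Theorems.ChebyshevTracialDesignFourBlocksAllModes

end
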